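import Literature.AlgebraicGeometry.HodgeTheory.PrimitiveClassesKunneth
import HarnessLib

/-!
# `ᶜΛ_{Y×Z} ∘ pr_Y^* = pr_Y^* ∘ ᶜΛ_Y` and `ᶜΛ_{Y×Z} ∘ pr_Z^* = pr_Z^* ∘ ᶜΛ_Z`: the projections intertwine the dual
# Lefschetz operators

Family `hodge`, lane `lit-hodgefound` (Track 2 foundations library), layer `Literature/AlgebraicGeometry/HodgeTheory`;
prover seat `lit-hodgefound-p21` (generation 37, row g37-#7), a sorite on `HodgeTheory/LefschetzOperatorsKunneth` (g36-#2:
Kleiman's `ᶜΛ_{Y×Z}(a × b) = ᶜΛ_Y a × b + a × ᶜΛ_Z b`, `dual_kunnethCross_tmul`) and `HodgeTheory/PrimitiveClassesKunneth`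
(g37-#2: `1_Z ∈ P⁰(Z)`).  THEOREMS ONLY (no definition, no named fact, no instance; D-0026 net debt `0`).

## Sources, VERBATIM, and what is a corollary

* S. Kleiman, *Algebraic cycles and the Weil conjectures* (1968) [Kleiman1968AlgebraicCycles], Thm. 2.9 (proof):
  `Λ_{X×Y} = Λ_X ⊗ 1 + 1 ⊗ Λ_Y` for the product polarization (the tree's `dual_kunnethCross_tmul`, g36-#2).
* Y. André, Publ. Math. IHÉS 83 (1996) [Andre1996Motifs], §1.1 p. 10: the formula for `ᶜΛ` on a string, in particular
  `ᶜΛ x₀ = 0` for `x₀` primitive (the tree's `HasLefschetzProperty.dual_apply_primitive`); §1.3 p. 12: «L'isomorphisme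
  (d'algèbres graduées) de Künneth `H•(X × Y) ≅ H•(X) ⊗ H•(Y)` devient un isomorphisme de `𝔰𝔩₂`-modules si l'on munit
  `X × Y` du faisceau inversible ample `p_X^* 𝓛_X ⊗ p_Y^* 𝓛_Y`».
* E. Looijenga, V. A. Lunts, Invent. Math. 129 (1997) [LooijengaLunts1997], §1 (1.1) p. 4: `f ⊗ 1 + 1 ⊗ f` on `M' ⊠ M''`.
* COROLLARY proved here (the case `b = 1_Z` of Kleiman's formula, with `ᶜΛ_Z 1_Z = 0` since `1_Z ∈ P⁰(Z)` is a
  lowest-weight vector, and `a × 1_Z = pr_Y^* a`): `ᶜΛ_{Y×Z}(pr_Y^* a) = pr_Y^*(ᶜΛ_Y a)`.  Note that `pr_Y^*` is NOT a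
  morphism of `𝔰𝔩₂`-modules (`h_{m+n} ∘ pr_Y^* ≠ pr_Y^* ∘ h_m` as soon as `n > 0`, and
  `L_θ(pr_Y^* a) = pr_Y^*(L_η a) + pr_Y^* a ⌣ pr_Z^* η'`); only `ᶜΛ` is intertwined.

## WHAT IS PROVED (`Y`, `Z` smooth projective of dimensions `m`, `n`, `m + n > 0`; `η`, `η'` hard Lefschetz; `ᶜΛ_{Y×Z}` is the
dual Lefschetz operator of `θ = pr_Y^* η + pr_Z^* η'`, `ᶜΛ_Y` that of `η`, `ᶜΛ_Z` that of `η'`; all on total cohomology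
`H•(−(ℂ); ℂ)`)

**`dual_totalPullback_fst`** (`ᶜΛ_{Y×Z}(pr_Y^* a) = pr_Y^*(ᶜΛ_Y a)`), **`dual_totalPullback_snd`**
(`ᶜΛ_{Y×Z}(pr_Z^* b) = pr_Z^*(ᶜΛ_Z b)`), the iterates `pow_dual_totalPullback_fst`, `pow_dual_totalPullback_snd` (`ᶜΛ^k`),
and `dual_totalPullback_fst_eq_zero`, `dual_totalPullback_snd_eq_zero` (`pr^*` of a lowest-weight vector — an element of
`ker ᶜΛ = ⊕_k P_{-k}` — is a lowest-weight vector).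

## References

* [Kleiman1968AlgebraicCycles] S. Kleiman, *Algebraic cycles and the Weil conjectures*, in: Dix exposés sur la cohomologie
  des schémas (1968), §1.4 (1.4.6), Thm. 2.9.
* [Andre1996Motifs] Y. André, Publ. Math. IHÉS 83 (1996), §1.1 (p. 10), §1.3 (p. 12).
* [LooijengaLunts1997] E. Looijenga, V. A. Lunts, Invent. Math. 129 (1997), §1 (1.1) p. 4.
* [HatcherAT2002] A. Hatcher, *Algebraic Topology* (2002), §3.2 p. 210 (`a × 1 = p^* a`), Thm. 3.16.
-/

noncomputable section

open CategoryTheory MonoidalCategory CartesianMonoidalCategory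
open scoped TensorProduct
open Literature.AlgebraicTopology.SingularHomology
open Literature.AlgebraicGeometry.Motives
open Literature.AlgebraicGeometry.Hyperkaehler
open Literature.Geometry.Kaehler
open Literature.Algebra.Lie
open Literature.Algebra.Lie.HasLefschetzProperty (primitiveSpace mem_primitiveSpace_iff)

namespace Literature.AlgebraicGeometry.HodgeTheory

variable {m n : ℕ} {Y Z : SchemeOver ℂ}

section Projections

variable (hY : IsSmoothProjective m Y) (hZ : IsSmoothProjective n Z) {η : complexBetti Y 2} {η' : complexBetti Z 2}
  (hη : HasHardLefschetzProperty η m) (hη' : HasHardLefschetzProperty η' n)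

/-- **`ᶜΛ_{Y×Z}(pr_Y^* a) = pr_Y^*(ᶜΛ_Y a)`** for every `a ∈ H•(Y(ℂ); ℂ)` (`m + n > 0`): the case `b = 1_Z` of Kleiman's
`ᶜΛ_{Y×Z}(a × b) = ᶜΛ_Y a × b + a × ᶜΛ_Z b`, since `ᶜΛ_Z 1_Z = 0` (`1_Z ∈ P⁰(Z)` is a lowest-weight vector) and
`a × 1_Z = pr_Y^* a` (corollary, as explained in the module docstring). [cite: Kleiman1968AlgebraicCycles, Thm. 2.9 (proof)]
[cite: Andre1996Motifs, §1.1 (p. 10, ᶜΛ x₀ = 0) and §1.3 (p. 12)] [cite: HatcherAT2002, §3.2 p. 210] -/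
theorem dual_totalPullback_fst (hmn : 0 < m + n) (a : totalCohomology ℂ (ComplexPoints Y)) :
    haveI := finite_totalCohomology hY
    haveI := finite_totalCohomology (IsSmoothProjective.tensor_holds hY hZ)
    (hasLefschetzProperty_complexPoints (IsSmoothProjective.tensor_holds hY hZ)
          (hasHardLefschetzProperty_map_fst_add_map_snd hY hZ hη hη')).dual (isZGrading_degreeOperator (m + n))
        (totalPullback ℂ (AlgPoints.mapContinuous (L := ℂ) (fst Y Z)) a) =
      totalPullback ℂ (AlgPoints.mapContinuous (L := ℂ) (fst Y Z))
        ((hasLefschetzProperty_complexPoints hY hη).dual (isZGrading_degreeOperator m) a) := by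
  haveI := finite_totalCohomology hY
  haveI := finite_totalCohomology hZ
  haveI := finite_totalCohomology (IsSmoothProjective.tensor_holds hY hZ)
  have hq := (ofDegree_mem_primitiveSpace_iff (show 0 + n = n by omega) η' _).2 (one_mem_lefschetzPrimitive hZ η')
  have h1 := dual_kunnethCross_tmul hY hZ hη hη' hmn a
    (ofDegree ℂ (ComplexPoints Z) 0 (singularCohomology.one ℂ (ComplexPoints Z)))
  rwa [(hasLefschetzProperty_complexPoints hZ hη').dual_apply_primitive (isZGrading_degreeOperator n) hq,
    TensorProduct.tmul_zero, map_zero, add_zero, totalCross_tmul_one, totalCross_tmul_one] at h1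

/-- **`ᶜΛ_{Y×Z}(pr_Z^* b) = pr_Z^*(ᶜΛ_Z b)`** for every `b ∈ H•(Z(ℂ); ℂ)` (`m + n > 0`): the case `a = 1_Y` of Kleiman's
formula (`ᶜΛ_Y 1_Y = 0`, `1_Y × b = pr_Z^* b`). [cite: Kleiman1968AlgebraicCycles, Thm. 2.9 (proof)]
[cite: Andre1996Motifs, §1.1 (p. 10, ᶜΛ x₀ = 0) and §1.3 (p. 12)] [cite: HatcherAT2002, §3.2 p. 210] -/
theorem dual_totalPullback_snd (hmn : 0 < m + n) (b : totalCohomology ℂ (ComplexPoints Z)) :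
    haveI := finite_totalCohomology hZ
    haveI := finite_totalCohomology (IsSmoothProjective.tensor_holds hY hZ)
    (hasLefschetzProperty_complexPoints (IsSmoothProjective.tensor_holds hY hZ)
          (hasHardLefschetzProperty_map_fst_add_map_snd hY hZ hη hη')).dual (isZGrading_degreeOperator (m + n))
        (totalPullback ℂ (AlgPoints.mapContinuous (L := ℂ) (snd Y Z)) b) =
      totalPullback ℂ (AlgPoints.mapContinuous (L := ℂ) (snd Y Z))
        ((hasLefschetzProperty_complexPoints hZ hη').dual (isZGrading_degreeOperator n) b) := by
  haveI := finite_totalCohomology hY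
  haveI := finite_totalCohomology hZ
  haveI := finite_totalCohomology (IsSmoothProjective.tensor_holds hY hZ)
  have hp := (ofDegree_mem_primitiveSpace_iff (show 0 + m = m by omega) η _).2 (one_mem_lefschetzPrimitive hY η)
  have h1 := dual_kunnethCross_tmul hY hZ hη hη' hmn
    (ofDegree ℂ (ComplexPoints Y) 0 (singularCohomology.one ℂ (ComplexPoints Y))) b
  rwa [(hasLefschetzProperty_complexPoints hY hη).dual_apply_primitive (isZGrading_degreeOperator m) hp,
    TensorProduct.zero_tmul, map_zero, zero_add, totalCross_one_tmul, totalCross_one_tmul] at h1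

/-- **`ᶜΛ_{Y×Z}^k (pr_Y^* a) = pr_Y^*(ᶜΛ_Y^k a)`** (iterate `dual_totalPullback_fst`).
[cite: Kleiman1968AlgebraicCycles, Thm. 2.9 (proof)] [cite: Andre1996Motifs, §1.3 (p. 12)] -/
theorem pow_dual_totalPullback_fst (hmn : 0 < m + n) (k : ℕ) (a : totalCohomology ℂ (ComplexPoints Y)) :
    haveI := finite_totalCohomology hY
    haveI := finite_totalCohomology (IsSmoothProjective.tensor_holds hY hZ)
    ((hasLefschetzProperty_complexPoints (IsSmoothProjective.tensor_holds hY hZ)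
          (hasHardLefschetzProperty_map_fst_add_map_snd hY hZ hη hη')).dual (isZGrading_degreeOperator (m + n)) ^ k)
        (totalPullback ℂ (AlgPoints.mapContinuous (L := ℂ) (fst Y Z)) a) =
      totalPullback ℂ (AlgPoints.mapContinuous (L := ℂ) (fst Y Z))
        (((hasLefschetzProperty_complexPoints hY hη).dual (isZGrading_degreeOperator m) ^ k) a) := by
  induction k generalizing a with
  | zero => simp only [pow_zero, Module.End.one_apply]
  | succ k ih =>
    rw [pow_succ', Module.End.mul_apply, ih, dual_totalPullback_fst hY hZ hη hη' hmn, ← Module.End.mul_apply,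
      ← pow_succ']

/-- **`ᶜΛ_{Y×Z}^k (pr_Z^* b) = pr_Z^*(ᶜΛ_Z^k b)`** (iterate `dual_totalPullback_snd`).
[cite: Kleiman1968AlgebraicCycles, Thm. 2.9 (proof)] [cite: Andre1996Motifs, §1.3 (p. 12)] -/
theorem pow_dual_totalPullback_snd (hmn : 0 < m + n) (k : ℕ) (b : totalCohomology ℂ (ComplexPoints Z)) :
    haveI := finite_totalCohomology hZ
    haveI := finite_totalCohomology (IsSmoothProjective.tensor_holds hY hZ)
    ((hasLefschetzProperty_complexPoints (IsSmoothProjective.tensor_holds hY hZ)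
          (hasHardLefschetzProperty_map_fst_add_map_snd hY hZ hη hη')).dual (isZGrading_degreeOperator (m + n)) ^ k)
        (totalPullback ℂ (AlgPoints.mapContinuous (L := ℂ) (snd Y Z)) b) =
      totalPullback ℂ (AlgPoints.mapContinuous (L := ℂ) (snd Y Z))
        (((hasLefschetzProperty_complexPoints hZ hη').dual (isZGrading_degreeOperator n) ^ k) b) := by
  induction k generalizing b with
  | zero => simp only [pow_zero, Module.End.one_apply]
  | succ k ih =>
    rw [pow_succ', Module.End.mul_apply, ih, dual_totalPullback_snd hY hZ hη hη' hmn, ← Module.End.mul_apply,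
      ← pow_succ']

/-- **`pr_Y^*` maps lowest-weight vectors to lowest-weight vectors**: `ᶜΛ_Y a = 0 ⟹ ᶜΛ_{Y×Z}(pr_Y^* a) = 0` («the primitive
elements are exactly the lowest weight elements»; `ker ᶜΛ = ⊕_k P_{-k}`). [cite: Kleiman1968AlgebraicCycles, Thm. 2.9 (proof)]
[cite: Andre1996Motifs, §1.1 (p. 10) and §1.3 (p. 12)] -/
theorem dual_totalPullback_fst_eq_zero (hmn : 0 < m + n) {a : totalCohomology ℂ (ComplexPoints Y)}
    (ha : haveI := finite_totalCohomology hY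
      (hasLefschetzProperty_complexPoints hY hη).dual (isZGrading_degreeOperator m) a = 0) :
    haveI := finite_totalCohomology (IsSmoothProjective.tensor_holds hY hZ)
    (hasLefschetzProperty_complexPoints (IsSmoothProjective.tensor_holds hY hZ)
          (hasHardLefschetzProperty_map_fst_add_map_snd hY hZ hη hη')).dual (isZGrading_degreeOperator (m + n))
        (totalPullback ℂ (AlgPoints.mapContinuous (L := ℂ) (fst Y Z)) a) = 0 := by
  have h1 := dual_totalPullback_fst hY hZ hη hη' hmn a
  rwa [ha, map_zero] at h1

/-- **`pr_Z^*` maps lowest-weight vectors to lowest-weight vectors**: `ᶜΛ_Z b = 0 ⟹ ᶜΛ_{Y×Z}(pr_Z^* b) = 0`.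
[cite: Kleiman1968AlgebraicCycles, Thm. 2.9 (proof)] [cite: Andre1996Motifs, §1.1 (p. 10) and §1.3 (p. 12)] -/
theorem dual_totalPullback_snd_eq_zero (hmn : 0 < m + n) {b : totalCohomology ℂ (ComplexPoints Z)}
    (hb : haveI := finite_totalCohomology hZ
      (hasLefschetzProperty_complexPoints hZ hη').dual (isZGrading_degreeOperator n) b = 0) :
    haveI := finite_totalCohomology (IsSmoothProjective.tensor_holds hY hZ)
    (hasLefschetzProperty_complexPoints (IsSmoothProjective.tensor_holds hY hZ)
          (hasHardLefschetzProperty_map_fst_add_map_snd hY hZ hη hη')).dual (isZGrading_degreeOperator (m + n))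
        (totalPullback ℂ (AlgPoints.mapContinuous (L := ℂ) (snd Y Z)) b) = 0 := by
  have h1 := dual_totalPullback_snd hY hZ hη hη' hmn b
  rwa [hb, map_zero] at h1

end Projections

end Literature.AlgebraicGeometry.HodgeTheory

end
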